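import Summits.Ventures.QEC.Census.LRATLeavesBB
import HarnessLib

/-!
# Kernel-B certificates WITHOUT a symmetry lemma: cube leaves + completeness CNFs over the base

Cell `qec`, PARTITION v2 row type-11 — assembly for qec-search-2's LEMMA-FREE scheme `cubes` (`enc-v2f`,
e.g. cert bc816cfe7067fa95 for `[[72,12,6]]`: 1 988 leaves) and for any future code without a usable
automorphism group (hypergraph products, generic two-block codes):

* `hammingNorm_gt_of_freeLeaves` — leaves `base ++ units q` (`q ∈ leaves`) all UNSAT, and the GLOBAL
  completeness CNF `base ++ [¬q : q ∈ leaves]` UNSAT (`kb/cubes.py completeness_clauses_free`: «every model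
  of the base lies in some leaf») ⟹ every logical has weight `> w`.  No hypothesis on the leaf literals at
  all (they may mention auxiliary variables): the model of the base produced by ENCODING SOUNDNESS itself
  satisfies some leaf.
* `hammingNorm_gt_of_rootLeaves` — the per-root split the solver seat offered for large completeness proofs:
  for each coordinate `e < n`, leaves `base ++ units (pinZeros e ++ q)` (`q ∈ cubes e`, root literal `x_e`
  inside `q`) and the completeness CNF `base ++ units (pinZeros e ++ [x_e]) ++ [¬q : q ∈ cubes e]`; the case
  split «the first support element of `v` is `e`» is elementary (every logical is nonzero), so again no
  symmetry lemma is needed.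
Both end in the hypothesis shape of `CSSCode.le_dX` / `le_dZ` exactly like `LRATLeaves.le_dX_of_leaves`.
-/

namespace Summit.Ventures.QEC.Census.LRATBridge

open Std.Sat Summit.Ventures.QEC.Census.CNFEncode
open Literature.InformationTheory.QuantumCodes Matrix

/-- The clause «cube `q` fails»: some literal of `q` is false. -/
def negClause (q : List (Literal ℕ)) : Clause := q.map fun l => (l.1, !l.2)

/-- If `negClause q` is false under `a` then `a` satisfies every literal of `q`. -/
theorem satLits_of_negClause_eval_false (a : ℕ → Bool) (q : List (Literal ℕ))
    (h : CNF.Clause.eval a (negClause q) = false) : SatLits a q := by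
  intro l hl
  rw [clause_eval_false_iff] at h
  have := h (l.1, !l.2) (List.mem_map.2 ⟨l, hl, rfl⟩)
  revert this
  cases a l.1 <;> cases l.2 <;> simp

/-- A model of the base that falsifies the CNF `base ++ extra` falsifies some clause of `extra`. -/
theorem exists_eval_false_of_append_unsat {base : CNF Nat} {extra : List Clause} (a : ℕ → Bool)
    (hbase : base.Sat a) (h : (base ++ (⟨extra.toArray⟩ : CNF Nat)).Unsat) :
    ∃ c ∈ extra, CNF.Clause.eval a c = false := by
  have he := h a
  rw [CNF.Sat] at hbase
  rw [CNF.eval_append, hbase, Bool.true_and] at he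
  simp only [CNF.eval, List.all_toArray, List.all_eq_false] at he
  obtain ⟨c, hc, hfalse⟩ := he
  exact ⟨c, hc, by simpa using hfalse⟩

/-- A model of the base satisfying all literals of `q` is a model of the leaf `base ++ units (pre ++ q)`
when it also satisfies `pre`. -/
theorem leaf_sat_of_satLits {n w : ℕ} {rows us : List (List ℕ)} (pre q : List (Literal ℕ)) (a : ℕ → Bool)
    (hbase : (cnfEncodeAny n rows us w).Sat a) (hpre : SatLits a pre) (hq : SatLits a q) :
    (leafCNF n rows us w pre q).Sat a := by
  rw [CNF.Sat] at hbase ⊢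
  rw [leafCNF, CNF.eval_append, hbase, Bool.true_and]
  have : (⟨(units (pre ++ q)).toArray⟩ : CNF Nat).Sat a := by
    rw [sat_mk_iff]
    refine units_eval a (pre ++ q) fun l hl => ?_
    rcases List.mem_append.1 hl with hl | hl
    · exact hpre l hl
    · exact hq l hl
  exact this

/-- **Lemma-free K2 lower bound (global completeness).**  If every leaf `base ++ units q`, `q ∈ leaves`, is
UNSAT and the completeness CNF `base ++ [negClause q : q ∈ leaves]` is UNSAT, then every `v ∈ ker H ∖ R`
has weight `> w` (given `hlog`).  The leaf literals are unrestricted. -/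
theorem hammingNorm_gt_of_freeLeaves {m n k w : ℕ} (H : Matrix (Fin m) (Fin n) (ZMod 2))
    (R : Submodule (ZMod 2) (Fin n → ZMod 2)) (L : Fin k → Fin n → ZMod 2)
    (rows us : List (List ℕ)) (hrows : rowSupports H = rows) (hus : supports L = us)
    (leaves : List (List (Literal ℕ)))
    (hleaf : ∀ q ∈ leaves, (leafCNF n rows us w [] q).Unsat)
    (hcomplete : (cnfEncodeAny n rows us w ++ (⟨(leaves.map negClause).toArray⟩ : CNF Nat)).Unsat)
    (hlog : ∀ v : Fin n → ZMod 2, H *ᵥ v = 0 → v ∉ R → ∃ j, L j ⬝ᵥ v ≠ 0)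
    (v : Fin n → ZMod 2) (hv : H *ᵥ v = 0) (hvR : v ∉ R) : w < hammingNorm v := by
  subst hrows hus
  by_contra hle
  have hsol := solvesAny_of_vector H L v hv (hlog v hv hvR) (Nat.le_of_not_lt hle)
  obtain ⟨a', -, hbase⟩ := cnfEncodeAny_sat_of_solves (rowSupports_lt H) (supports_lt L) hsol
  obtain ⟨c, hc, hfalse⟩ := exists_eval_false_of_append_unsat a' hbase hcomplete
  simp only [List.mem_map] at hc
  obtain ⟨q, hq, rfl⟩ := hc
  have hsat := leaf_sat_of_satLits [] q a' hbase (fun _ h => by simp at h)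
    (satLits_of_negClause_eval_false a' q hfalse)
  have := hleaf q hq a'
  rw [CNF.Sat] at hsat
  rw [hsat] at this
  exact Bool.noConfusion this

/-- The root-`e` completeness CNF: base, the pins «bits `< e` clear, bit `e` set», and `¬q` for each cube. -/
def rootCoverCNF (n : ℕ) (rows us : List (List ℕ)) (w e : ℕ) (cubes : List (List (Literal ℕ))) :
    CNF Nat :=
  leafCNF n rows us w (pinZeros e) [(e, true)] ++ (⟨(cubes.map negClause).toArray⟩ : CNF Nat)

/-- A nonzero flat vector has a FIRST support index `e`: bits `< e` clear, bit `e` set. -/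
theorem exists_first_index {n : ℕ} (v : Fin n → ZMod 2) (hv : v ≠ 0) :
    ∃ e : Fin n, v e ≠ 0 ∧ ∀ i : Fin n, (i : ℕ) < e → v i = 0 := by
  classical
  have hex : ∃ e : ℕ, ∃ h : e < n, v ⟨e, h⟩ ≠ 0 := by
    by_contra hnone
    apply hv
    funext i
    by_contra hi
    exact hnone ⟨i, i.isLt, hi⟩
  obtain ⟨hlt, hne⟩ := Nat.find_spec hex
  refine ⟨⟨Nat.find hex, hlt⟩, hne, fun i hi => ?_⟩
  by_contra hi'
  exact Nat.find_min hex hi ⟨i.isLt, hi'⟩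

/-- **Lemma-free K2 lower bound (per-root completeness)**: cubes indexed by the first support element. -/
theorem hammingNorm_gt_of_rootLeaves {m n k w : ℕ} (H : Matrix (Fin m) (Fin n) (ZMod 2))
    (R : Submodule (ZMod 2) (Fin n → ZMod 2)) (L : Fin k → Fin n → ZMod 2)
    (rows us : List (List ℕ)) (hrows : rowSupports H = rows) (hus : supports L = us)
    (cubes : ℕ → List (List (Literal ℕ)))
    (hleaf : ∀ e < n, ∀ q ∈ cubes e, (leafCNF n rows us w (pinZeros e) q).Unsat)
    (hcomplete : ∀ e < n, (rootCoverCNF n rows us w e (cubes e)).Unsat)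
    (hlog : ∀ v : Fin n → ZMod 2, H *ᵥ v = 0 → v ∉ R → ∃ j, L j ⬝ᵥ v ≠ 0)
    (v : Fin n → ZMod 2) (hv : H *ᵥ v = 0) (hvR : v ∉ R) : w < hammingNorm v := by
  subst hrows hus
  by_contra hle
  have hv0 : v ≠ 0 := by rintro rfl; exact hvR (Submodule.zero_mem R)
  obtain ⟨e, he, hmin⟩ := exists_first_index v hv0
  have hsol := solvesAny_of_vector H L v hv (hlog v hv hvR) (Nat.le_of_not_lt hle)
  obtain ⟨a', ha', hbase⟩ := cnfEncodeAny_sat_of_solves (rowSupports_lt H) (supports_lt L) hsol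
  -- `a'` satisfies the pins of root `e`
  have hpins : SatLits a' (pinZeros e) := by
    intro l hl
    have hl' := satLits_pinZeros v (le_of_lt e.isLt) hmin l hl
    rwa [ha' l.1 (pinZeros_lt (le_of_lt e.isLt) l hl)]
  have hroot : SatLits a' [((e : ℕ), true)] := by
    intro l hl
    simp only [List.mem_singleton] at hl
    subst hl
    show a' e = true
    rw [ha' e e.isLt]
    exact toAssign_eq_true_of_ne v e he
  -- so it is a model of the root-`e` leaf without cube, hence falsifies some `negClause q`
  have hbase' : (leafCNF n (rowSupports H) (supports L) w (pinZeros e) [((e : ℕ), true)]).Sat a' :=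
    leaf_sat_of_satLits _ _ a' hbase hpins hroot
  obtain ⟨c, hc, hfalse⟩ := exists_eval_false_of_append_unsat a' hbase' (hcomplete e e.isLt)
  simp only [List.mem_map] at hc
  obtain ⟨q, hq, rfl⟩ := hc
  have hsat := leaf_sat_of_satLits (pinZeros e) q a' hbase hpins
    (satLits_of_negClause_eval_false a' q hfalse)
  have := hleaf e e.isLt q hq a'
  rw [CNF.Sat] at hsat
  rw [hsat] at this
  exact Bool.noConfusion this

/-- **`d ≤ d^Z` lemma-free** (global completeness; `H = H^X`, `R = rs H^Z`, `L = LX`, `w = d-1`). -/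
theorem le_dZ_of_freeLeaves {mX mZ n k : ℕ} (C : CSSCode (Fin mX) (Fin mZ) (Fin n))
    (LX : Fin k → Fin n → ZMod 2) (d : ℕ) (rows us : List (List ℕ))
    (hrows : rowSupports C.HX = rows) (hus : supports LX = us) (leaves : List (List (Literal ℕ)))
    (hleaf : ∀ q ∈ leaves, (leafCNF n rows us (d - 1) [] q).Unsat)
    (hcomplete : (cnfEncodeAny n rows us (d - 1) ++ (⟨(leaves.map negClause).toArray⟩ : CNF Nat)).Unsat)
    (hlog : ∀ v : Fin n → ZMod 2, C.HX *ᵥ v = 0 → v ∉ C.rowSpZ → ∃ j, LX j ⬝ᵥ v ≠ 0)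
    (hex : ∃ v : Fin n → ZMod 2, C.HX *ᵥ v = 0 ∧ v ∉ C.rowSpZ) : d ≤ C.dZ := by
  refine C.le_dZ hex fun v hv hv' => ?_
  have := hammingNorm_gt_of_freeLeaves C.HX C.rowSpZ LX rows us hrows hus leaves hleaf hcomplete hlog
    v hv hv'
  omega

/-- **`d ≤ d^Z` lemma-free** (per-root completeness). -/
theorem le_dZ_of_rootLeaves {mX mZ n k : ℕ} (C : CSSCode (Fin mX) (Fin mZ) (Fin n))
    (LX : Fin k → Fin n → ZMod 2) (d : ℕ) (rows us : List (List ℕ))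
    (hrows : rowSupports C.HX = rows) (hus : supports LX = us) (cubes : ℕ → List (List (Literal ℕ)))
    (hleaf : ∀ e < n, ∀ q ∈ cubes e, (leafCNF n rows us (d - 1) (pinZeros e) q).Unsat)
    (hcomplete : ∀ e < n, (rootCoverCNF n rows us (d - 1) e (cubes e)).Unsat)
    (hlog : ∀ v : Fin n → ZMod 2, C.HX *ᵥ v = 0 → v ∉ C.rowSpZ → ∃ j, LX j ⬝ᵥ v ≠ 0)
    (hex : ∃ v : Fin n → ZMod 2, C.HX *ᵥ v = 0 ∧ v ∉ C.rowSpZ) : d ≤ C.dZ := by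
  refine C.le_dZ hex fun v hv hv' => ?_
  have := hammingNorm_gt_of_rootLeaves C.HX C.rowSpZ LX rows us hrows hus cubes hleaf hcomplete hlog
    v hv hv'
  omega

end Summit.Ventures.QEC.Census.LRATBridge
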